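/-
# B3OrphanPair — the ORPHAN-PAIR law for three-term letter designs (hsemireg-monad-1 g8; evidence on stmt-HodgeConjecture-18881)

token: line stmt-HodgeConjecture-18881 Cruxes/BlochSeedDiscOne/Lines/birth.lean 814a6a70c14e831a stub_rung_pad4_seedAt (helper)

Companion of the memo `B3-ORPHANPAIR-monad1-g8.md`.  Imports the cell model of `B3HubTrace` (hsemireg-monad-4
g13: `hfac`, `hj`, `n18`, `hub`, `p46`, `p53`, `p70`, `npos`, `IsISemiregularFamily`) and Mathlib; every
declaration fully proved; no type-class declarations, no custom syntax, no unsafe options.  Typed here: the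
CHECKABLE SKELETON of the pen theorem ORPHAN-PAIR:

* §1 the linear algebra of memo 2.1 (the CAPACITY COUNT): for linear maps `f : V₁ → W₁`, `g : V₂ → W₂` over a
  field, `rank (f ⊗ g) ≤ rank f · rank g`, hence `dim ker (f ⊗ g) ≥ dim V₁ · dim V₂ − rank f · rank g`
  `≥ dim V₁ · dim V₂ − min(dim V₁, dim W₁) · min(dim V₂, dim W₂)`; with the letter dimensions
  `(4, 2; 4, 2)` of an orphan pair this is `≥ 16 − 4 = 12`;
* §2 the letter facts of the famdesign TWIST alphabet used by the proof, checked by `decide`: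
  (U) the sixteen `N18` cells are UNFED (`Hom(A, N18) = 0`, tree `h0_hom_A_n18`), (V) INVISIBLE from the hub
  (`H²(Hom(H, N18)) = 0`, tree `h2_hom_hub_n18`), (P) `h²(X, Hom(N18_u, N18_u')) = 16` exactly for the 48
  ordered pairs with the same phase and different position factors and `= 0` for every other ordered pair of
  distinct orphans, with the per-factor data `(h¹(A_k), h⁰(B_k), h¹(A_k B_k)) = (4, 2, 1)` on the own factor of
  `u` and `(4, 1, 2)` on the own factor of `u'` that feed §1;
* §3 the bound `orphanPairLB = 48 · 12 = 576`, independent of the hub multiplicity `c`, and its comparison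
  with the HUB-TRACE ray (tree `hubTraceLB`): the two TWIST-ray members `𝔇₁₂ = (52,172)`, `𝔇₁₃ = (51,173)`
  left silent by HUB-TRACE / BLOCK-TRACE (`hubTraceLB 12 12 = hubTraceLB 13 12 = 0`) get `≥ 576`.

Nothing here is a theorem about sheaves on an abelian variety: the geometric content (the cocycles
`w̃ − y`, their non-vanishing and σ-vanishing) is pen (memo §2).  Designs ≠ sheaves ≠ SEED; nothing is
proved toward HC / HC_CM / HC_AV / №4 / 26512 / 18881 / H2.
-/
import Summits.HodgeConjecture.HodgeConjecture.Cruxes.BlochSeedDiscOne.B3HubTrace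

namespace Summit.Ventures.HSemireg.B3OrphanPair

open Summit.Ventures.HSemireg.B3HubTrace
open scoped TensorProduct

/-! ## §1 Linear algebra of memo 2.1: the capacity count -/
section LinearAlgebra

variable {K : Type*} [Field K]
  {V₁ V₂ W₁ W₂ : Type*} [AddCommGroup V₁] [Module K V₁] [AddCommGroup V₂] [Module K V₂]
  [AddCommGroup W₁] [Module K W₁] [AddCommGroup W₂] [Module K W₂]
  [FiniteDimensional K V₁] [FiniteDimensional K V₂] [FiniteDimensional K W₁] [FiniteDimensional K W₂]

omit [FiniteDimensional K W₁] [FiniteDimensional K W₂] in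
/-- `rank (f ⊗ g) ≤ rank f · rank g` (the tensor map factors through `range f ⊗ range g`). -/
theorem finrank_range_map_le (f : V₁ →ₗ[K] W₁) (g : V₂ →ₗ[K] W₂) :
    Module.finrank K (LinearMap.range (TensorProduct.map f g)) ≤
      Module.finrank K (LinearMap.range f) * Module.finrank K (LinearMap.range g) := by
  have h : LinearMap.range (TensorProduct.map f g) =
      LinearMap.range (TensorProduct.mapIncl (LinearMap.range f) (LinearMap.range g)) := by
    rw [TensorProduct.range_map, TensorProduct.range_mapIncl]
  rw [h]
  calc Module.finrank K (LinearMap.range (TensorProduct.mapIncl (LinearMap.range f) (LinearMap.range g)))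
      ≤ Module.finrank K (↥(LinearMap.range f) ⊗[K] ↥(LinearMap.range g)) := LinearMap.finrank_range_le _
    _ = Module.finrank K (LinearMap.range f) * Module.finrank K (LinearMap.range g) :=
      Module.finrank_tensorProduct

omit [FiniteDimensional K W₁] [FiniteDimensional K W₂] in
/-- Memo 2.1, the CAPACITY COUNT: `dim ker (f ⊗ g) ≥ dim V₁ · dim V₂ − rank f · rank g`. -/
theorem finrank_ker_map_ge (f : V₁ →ₗ[K] W₁) (g : V₂ →ₗ[K] W₂) :
    Module.finrank K V₁ * Module.finrank K V₂ -
        Module.finrank K (LinearMap.range f) * Module.finrank K (LinearMap.range g) ≤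
      Module.finrank K (LinearMap.ker (TensorProduct.map f g)) := by
  have h1 := LinearMap.finrank_range_add_finrank_ker (TensorProduct.map f g)
  have h2 := finrank_range_map_le f g
  have h3 : Module.finrank K (V₁ ⊗[K] V₂) = Module.finrank K V₁ * Module.finrank K V₂ :=
    Module.finrank_tensorProduct
  omega

/-- The dimension-only form used letter by letter (`rank ≤ min(dim source, dim target)` per factor):
`dim ker (f ⊗ g) ≥ dim V₁ · dim V₂ − min(dim V₁, dim W₁) · min(dim V₂, dim W₂)`. -/
theorem finrank_ker_map_ge_dims (f : V₁ →ₗ[K] W₁) (g : V₂ →ₗ[K] W₂) :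
    Module.finrank K V₁ * Module.finrank K V₂ -
        min (Module.finrank K V₁) (Module.finrank K W₁) * min (Module.finrank K V₂) (Module.finrank K W₂) ≤
      Module.finrank K (LinearMap.ker (TensorProduct.map f g)) := by
  have ha : Module.finrank K (LinearMap.range f) ≤ min (Module.finrank K V₁) (Module.finrank K W₁) :=
    le_min (LinearMap.finrank_range_le f) (Submodule.finrank_le _)
  have hb : Module.finrank K (LinearMap.range g) ≤ min (Module.finrank K V₂) (Module.finrank K W₂) :=
    le_min (LinearMap.finrank_range_le g) (Submodule.finrank_le _)
  have hab := Nat.mul_le_mul ha hb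
  have h := finrank_ker_map_ge f g
  omega

/-- ORPHAN-PAIR in letters (memo 2.1 with the TWIST data of §2): `V₁ = H¹(S_k, A_k)` (dim 4) maps to
`W₁ = Hom(H⁰(B_k), H¹(A_k B_k))` (dim 2·1), `V₂ = H¹(S_{k'}, A_{k'})` (dim 4) to `W₂ = Hom(H⁰(B_{k'}), H¹(A_{k'} B_{k'}))`
(dim 1·2): at least `16 − 4 = 12` classes `w ∈ H²(X, Hom(N18_u, N18_{u'}))` with `w ∪ H⁰(Hom(N18_{u'}, H)) = 0`. -/
theorem orphanPair_capacity (f : V₁ →ₗ[K] W₁) (g : V₂ →ₗ[K] W₂)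
    (h₁ : Module.finrank K V₁ = 4) (h₂ : Module.finrank K V₂ = 4)
    (h₃ : Module.finrank K W₁ = 2) (h₄ : Module.finrank K W₂ = 2) :
    12 ≤ Module.finrank K (LinearMap.ker (TensorProduct.map f g)) := by
  have h := finrank_ker_map_ge_dims f g
  rw [h₁, h₂, h₃, h₄] at h
  simpa using h

variable {V : Type*} [AddCommGroup V] [Module K V] [FiniteDimensional K V]
  {ι : Type*} {T : ι → Type*} [∀ k, AddCommGroup (T k)] [∀ k, Module K (T k)]

/-- The verdict shape (tree `not_isISemiregularFamily_of_subspace`, g13): a positive-dimensional subspace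
in every `ker σ_k` refutes `I`-semiregularity for EVERY window `I` — here `Z` = the span of the orphan-pair
classes, `dim Z ≥ 576 > 0` (memo 2.2–2.3). -/
theorem orphanPair_verdict_shape (σ : (k : ι) → V →ₗ[K] T k) (Z : Submodule K V)
    (hZ : 576 ≤ Module.finrank K Z) (h : ∀ k, Z ≤ LinearMap.ker (σ k)) (I : Set ι) :
    ¬ IsISemiregularFamily σ I :=
  not_isISemiregularFamily_of_subspace σ I Z (by omega) h

end LinearAlgebra

/-! ## §2 The letter facts of the TWIST alphabet used by the proof

Cells as in `B3HubTrace`: `n18 k a = (ω',1)@k ⊗ (iω',2)@sides`, `ω' = i^a`; `hub = (14,0)⁴`;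
A-letters `p46`, `p53`, `p70`; one-factor N-letters `npos c k a`, `c ∈ {1,2,3}`.  (U) and (V) are the
tree theorems `h0_hom_A_n18` and `h2_hom_hub_n18`; they are re-exported here in the form the memo cites. -/

/-- (U) the orphans are UNFED: `Hom(a, N18_u) = 0` for every A-letter `a` (tree `h0_hom_A_n18`). -/
theorem orphan_unfed : ∀ k a k' a' : Fin 4,
    hj 0 (p46 k a) (n18 k' a') = 0 ∧ hj 0 (p53 k a) (n18 k' a') = 0 ∧ hj 0 (p70 k a) (n18 k' a') = 0 :=
  h0_hom_A_n18

/-- (V) the orphans are INVISIBLE from the top: `H²(X, Hom(H, N18_u)) = 0` (tree `h2_hom_hub_n18`). -/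
theorem orphan_invisible : ∀ k a : Fin 4, hj 2 hub (n18 k a) = 0 := fun k a => (h2_hom_hub_n18 k a).1

/-- (P1) `h²(X, Hom(N18_u, N18_{u'})) = 16` for `u = (k, ω')`, `u' = (k', ω')` with the SAME phase and
different position factors `k ≠ k'`; all of it in the Künneth multidegree `e_k + e_{k'}` (P3 below). -/
theorem h2_hom_orphan_pair : ∀ k k' a : Fin 4, k ≠ k' → hj 2 (n18 k a) (n18 k' a) = 16 := by decide

/-- (P2) every OTHER ordered pair of distinct orphans has `h²(Hom) = 0` (different phases). -/
theorem h2_hom_orphan_other : ∀ k k' a a' : Fin 4, a ≠ a' → hj 2 (n18 k a) (n18 k' a') = 0 := by decide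

/-- (P3) the per-factor triples `(h⁰,h¹,h²)` of `A = Hom(N18_u, N18_{u'})` (same phase, `k ≠ k'`):
cross-chain `(0,4,0)` on the two position factors, trivial `(1,2,1)` on the two common sides — so the 16
classes are `H¹(S_k, A_k) ⊗ H¹(S_{k'}, A_{k'}) ⊗ H⁰ ⊗ H⁰`, and `h⁰(A) = h¹(A) = 0`. -/
theorem hfac_orphan_pair : ∀ k k' a f : Fin 4, k ≠ k' →
    hfac (n18 k a f) (n18 k' a f) = (if f = k ∨ f = k' then (0, 4, 0) else (1, 2, 1)) := by decide

theorem h01_hom_orphan_pair : ∀ k k' a : Fin 4, k ≠ k' →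
    hj 0 (n18 k a) (n18 k' a) = 0 ∧ hj 1 (n18 k a) (n18 k' a) = 0 := by decide

/-- (P4) the data of the capacity count on the position factor `k` of `u`:
`h¹(A_k) = 4`, `h⁰(B_k) = h⁰(Hom(N18_{u'}, H)_k) = 2`, `h¹(A_k B_k) = h¹(Hom(N18_u, H)_k) = 1`;
and on the position factor `k'` of `u'`: `h¹(A_{k'}) = 4`, `h⁰(B_{k'}) = 1`, `h¹(A_{k'} B_{k'}) = 2`.
(On the common sides `j_f = 0` and the factor is an isomorphism: `h⁰(A_f) = 1`.) -/
theorem capacity_data : ∀ k k' a : Fin 4, k ≠ k' →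
    (hfac (n18 k a k) (n18 k' a k)).2.1 = 4 ∧ (hfac (n18 k' a k) (hub k)).1 = 2 ∧
      (hfac (n18 k a k) (hub k)).2.1 = 1 ∧
    (hfac (n18 k a k') (n18 k' a k')).2.1 = 4 ∧ (hfac (n18 k' a k') (hub k')).1 = 1 ∧
      (hfac (n18 k a k') (hub k')).2.1 = 2 := by decide

/-- (P5) what the correction term `y` needs: `H²` of `Hom(N18_u, H)` vanishes factorwise in the degrees hit
by `q_{u'} ∘ w̃` — on the position factors `h²(Hom(N18_u,H)_f) = 0` (positive letters; tree
`posNull_hom_n18_hub`), so `[q_{u'} ∘ w̃] ∈ H¹ ⊗ H¹ ⊗ H⁰ ⊗ H⁰` and exactness is decided by the cup products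
of (P4) alone. -/
theorem h2_factor_hom_orphan_hub : ∀ k a f : Fin 4, (hfac (n18 k a f) (hub f)).2.2 = 0 :=
  fun k a f => (posNull_hom_n18_hub k a f).1

/-! ## §3 The bound, its independence of `c`, and the two newly decided ray members -/

/-- The ordered orphan pairs that carry classes: same phase `a`, position factors `k ≠ k'`. -/
def orphanPairs : List (Fin 4 × Fin 4 × Fin 4) :=
  ((List.finRange 4) ×ˢ ((List.finRange 4) ×ˢ (List.finRange 4))).filter fun t => t.1 ≠ t.2.1

theorem orphanPairs_length : orphanPairs.length = 48 := by decide

/-- Per pair: `h² − capacity = 16 − min(4, 2·1) · min(4, 1·2) = 12` (memo 2.1; §1 `orphanPair_capacity`). -/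
def pairLB (k k' a : Fin 4) : ℕ :=
  hj 2 (n18 k a) (n18 k' a) -
    min ((hfac (n18 k a k) (n18 k' a k)).2.1) ((hfac (n18 k' a k) (hub k)).1 * (hfac (n18 k a k) (hub k)).2.1) *
    min ((hfac (n18 k a k') (n18 k' a k')).2.1) ((hfac (n18 k' a k') (hub k')).1 * (hfac (n18 k a k') (hub k')).2.1)

theorem pairLB_eq : ∀ k k' a : Fin 4, k ≠ k' → pairLB k k' a = 12 := by decide

/-- ORPHAN-PAIR lower bound for the TWIST alphabet: `Σ_pairs pairLB = 48 · 12 = 576` — the number of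
`orphanpair.py` on `design-D48r48s176.json` and `design-X150r40s184.json` (memo §4). It does not depend on
the hub multiplicity `c`: the classes live on `Hom(N18_u, N18_{u'})` and `Hom(N18_u, H) ⊗ ℂ^c`, and the
capacity is computed per hub LETTER. -/
def orphanPairLB : ℕ := (orphanPairs.map fun t => pairLB t.1 t.2.1 t.2.2).sum

theorem orphanPairLB_eq : orphanPairLB = 576 := by decide

theorem orphanPairLB_pos : 0 < orphanPairLB := by decide

/-- The two TWIST-ray members HUB-TRACE / BLOCK-TRACE leave silent (`c − s ∈ {0,1}`, `s = 12`):
`𝔇₁₂ = (52,172)` and `𝔇₁₃ = (51,173)` — `hubTraceLB` gives 0 there, ORPHAN-PAIR gives 576. -/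
theorem newly_decided : hubTraceLB 12 12 = 0 ∧ hubTraceLB 13 12 = 0 ∧ 576 ≤ orphanPairLB := by decide

/-- The whole ray `𝔇_c`, `c = 12 … 28`: joint lower bound `hubTraceLB c 12 + 576` (the hub-twist classes of
g13 and the orphan-pair classes are jointly independent, memo 2.2 Remark) — positive at EVERY `c`. -/
theorem ray_table_joint : (List.range 17).map (fun t => hubTraceLB (12 + t) 12 + orphanPairLB) =
    [576, 576, 588, 608, 636, 672, 716, 768, 828, 896, 972, 1056, 1148, 1248, 1356, 1472, 1596] := by decide

theorem ray_dead_everywhere : ∀ t < 17, 0 < hubTraceLB (12 + t) 12 + orphanPairLB := by decide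

/-- Still a structural verdict, not a pigeonhole: `576 + 1020 < 3136 = dim H⁵(Ω³)` (tree `sigma_targets`). -/
theorem kernel_lt_target : hubTraceLB 28 12 + orphanPairLB < Nat.choose 8 3 * Nat.choose 8 5 := by decide

end Summit.Ventures.HSemireg.B3OrphanPair
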